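import Mathlib
import HarnessLib.Audit
import Summits.PneNP.PneNP.Theorems.PstarChordBridgeTools
import Summits.PneNP.PneNP.Theorems.PstarChordSystem

/-!
# The bridge: a terminal core with a chord set IS a chord system on the cube (ROUND-24, memo §9 R1, §10–11; GAPTWO-PLAN S4)

FRONTIER range-avoidance ladder, rung F-N3, ROUND 24 (cell `pnp-ideate`, planner memo `r24/CORE-BOUND-NOTES.md` §1–2 (x-elimination,
free-cube coordinates), §9 R1 ("free-cube parametrisation of V₀ … needs Assumption A"), §10 ("coordinates on V₀"), §11 (basis-free form);
restricted-model proof complexity — nothing here bears on `P` versus `NP`).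

R1 OF THE `CoreShape` CHAIN, PATH-FREE.  Data (`BridgeData`): a pure typed `P⋆` instance `I`, target bits `y`, a set `J₀` of outputs (the
core), a set `N ⊆ J₀` of CHORDS (`IsChord`: both AND variables private inside `J₀`), for every chord `e` a FUNDAMENTAL SET `D e ⊆ J₀ ∖ N` with
`D e + e` everywhere even in the XOR multigraph (the fundamental cycle — only its degree parities are used), and two G-constraints
`(Cᵢ, Gᵢ, bᵢ)` (`PstarGapOneAll.gval`) each with a JOIN `Tᵢ ⊆ J₀ ∖ N` of its XOR reads (odd-degree vertices of `Tᵢ` = the XOR vertices of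
`J₀ ∖ N` lying in `Cᵢ`).  Side conditions (`BridgeData.WF`): the above, plus NO CROSS PENDANT (no monomial of `Gᵢ` has both variables private).

From this data `sys I B : ChordSystem (Fin m) (Fin n → 𝔽₂)` (`PstarChordSystem`) is built on the FULL cube of all variables (privates and XOR
vertices are coordinates too, but nothing reads them): prescribed products `u e = uval = y_e + Σ_{j ∈ D e} (y_j + x_{p_j} x_{q_j})`
(`= γ_e + Q_{D_e}`), read vectors `ρ e = (coef₁ p_e, coef₂ p_e)`, `ρ' e = (coef₁ q_e, coef₂ q_e)`, state-free part `F = (free₁, free₂)`,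
target `t = (b₁, b₂)` (`PstarChordBridgeTools.uval / coef / free`).  Results:

* `val_sys` — the constraint values of the model in closed form;
* `val_of_solution`, `eval_iff_adm` — a solution `z` of the non-chord outputs, read as base point `bit ∘ z` with states `(z_{p_e}, z_{q_e})`,
  has model value `(gval₁ z, gval₂ z)`, and chord `e` holds at `z` iff its state is admissible (`p_e q_e = u_e`);
* `not_infeasible_of_solution` — a solution of `J₀ ∧ Γ₁ ∧ Γ₂` refutes `Infeasible` (so `Infeasible ⇒` the terminal system is unsolvable);
* `chordMinimal_of_solution_erase` — **(M0) ⇒ chord-minimal**: a solution of `(J₀ − e) ∧ Γ₁ ∧ Γ₂` makes the model chord-minimal in `e`;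
* `infeasible_of_not_solution` — **(T3) ⇒ infeasible**, given the LIFT property of the non-chord part (every assignment can be corrected on the
  XOR vertices of `J₀ ∖ N` to satisfy `J₀ ∖ N`; this is what "`J₀ ∖ N` is a forest" buys: `PstarChordBridgeLift.lift_of_peelable`).

So every theorem of the model layer (`PstarChordSystem`: R2 pointwise sumset, M-read, M-forced, (★★), R5 direction collapse, R6 no free lunch;
`PstarChordForcing.forced_chord_cases`) now speaks about terminal cores (`PstarGapTwoAssembly.CoreBoundAt` data) with a forest of non-chords.
What the bridge does NOT cover (memo O1/O2): chord sets whose complement is not liftable (centre cycles), CROSS pendants, and constraints whose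
XOR reads admit no join (odd on a component — the R6 / h = 1 situation, to be discharged separately).
-/

set_option linter.dupNamespace false -- `Summit.PneNP.PneNP.…`: summit = sub-problem name (D-0017 single-conjunct layout)

open Finset Literature.Computability.Complexity
open Summit.PneNP.PneNP.Theorems.PstarFibrePolys (bit bit_xor bit_and bit_injective)
open Summit.PneNP.PneNP.Theorems.PstarPDT (parity bit_eval)
open Summit.PneNP.PneNP.Theorems.PstarTyped (Typed)
open Summit.PneNP.PneNP.Theorems.PstarSALevel (varSet bdry)
open Summit.PneNP.PneNP.Theorems.PstarGapOneAll (gval)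
open Summit.PneNP.PneNP.Theorems.PstarXorElimination (pdeg)
open Summit.PneNP.PneNP.Theorems.PstarXCore (xpair xverts mem_xpair)
open Summit.PneNP.PneNP.Theorems.PstarChordRepair (IsChord)
open Summit.PneNP.PneNP.Theorems.PstarGapPeeling (eval_congr)
open Summit.PneNP.PneNP.Theorems.PstarReadSumset (V2)
open Summit.PneNP.PneNP.Theorems.PstarChordSystem (ChordSystem)
open Summit.PneNP.PneNP.Theorems.PstarChordBridgeTools

namespace Summit.PneNP.PneNP.Theorems.PstarChordBridge

variable {n m : ℕ}

/-! ## The data and its side conditions -/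

/-- **Bridge data**: targets, core, chords, fundamental sets, and two G-constraints with joins of their XOR reads. -/
structure BridgeData (n m : ℕ) where
  /-- target bits -/
  y : Fin m → Bool
  /-- the core -/
  J₀ : Finset (Fin m)
  /-- the chords (co-tree) -/
  N : Finset (Fin m)
  /-- fundamental set of a chord: `D e ⊆ J₀ ∖ N` with `D e + e` everywhere even -/
  D : Fin m → Finset (Fin m)
  /-- linear part of the first constraint -/
  C₁ : Finset (Fin n)
  /-- monomials of the first constraint -/
  G₁ : Finset (Fin m)
  /-- target of the first constraint -/
  b₁ : Bool
  /-- join of the XOR reads of the first constraint -/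
  T₁ : Finset (Fin m)
  /-- linear part of the second constraint -/
  C₂ : Finset (Fin n)
  /-- monomials of the second constraint -/
  G₂ : Finset (Fin m)
  /-- target of the second constraint -/
  b₂ : Bool
  /-- join of the XOR reads of the second constraint -/
  T₂ : Finset (Fin m)

/-- **Well-formedness** of bridge data on the instance `I` (all conditions are degree parities and memberships — no paths). -/
structure BridgeData.WF (I : LocalMap 4 n m) (B : BridgeData n m) : Prop where
  /-- chords lie in the core -/
  hN : B.N ⊆ B.J₀
  /-- chords are chords of the core -/
  hchord : ∀ e ∈ B.N, IsChord I B.J₀ e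
  /-- fundamental sets consist of non-chords -/
  hD : ∀ e ∈ B.N, B.D e ⊆ B.J₀ \ B.N
  /-- `D e + e` is an even subgraph of the XOR multigraph -/
  hDeven : ∀ e ∈ B.N, ∀ w, Even (xpdeg I (insert e (B.D e)) w)
  /-- joins consist of non-chords -/
  hT₁ : B.T₁ ⊆ B.J₀ \ B.N
  /-- joins consist of non-chords -/
  hT₂ : B.T₂ ⊆ B.J₀ \ B.N
  /-- `T₁` joins the XOR reads of the first constraint -/
  hjoin₁ : ∀ w, Odd (xpdeg I B.T₁ w) ↔ w ∈ B.C₁ ∧ w ∈ xverts I (B.J₀ \ B.N)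
  /-- `T₂` joins the XOR reads of the second constraint -/
  hjoin₂ : ∀ w, Odd (xpdeg I B.T₂ w) ↔ w ∈ B.C₂ ∧ w ∈ xverts I (B.J₀ \ B.N)
  /-- no cross pendant in the first constraint -/
  hcross₁ : ∀ g ∈ B.G₁, ¬ (I.vars g 2 ∈ privs I B.N ∧ I.vars g 3 ∈ privs I B.N)
  /-- no cross pendant in the second constraint -/
  hcross₂ : ∀ g ∈ B.G₂, ¬ (I.vars g 2 ∈ privs I B.N ∧ I.vars g 3 ∈ privs I B.N)

/-- `z` SOLVES the terminal system on the output set `K`: all outputs of `K` and both G-constraints. -/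
def Solution (I : LocalMap 4 n m) (B : BridgeData n m) (K : Finset (Fin m)) (z : Fin n → Bool) : Prop :=
  (∀ j ∈ K, I.eval z j = B.y j) ∧ gval I B.C₁ B.G₁ z = B.b₁ ∧ gval I B.C₂ B.G₂ z = B.b₂

/-- The LIFT property of the non-chord part: every assignment can be corrected on the XOR vertices of `J₀ ∖ N` to satisfy `J₀ ∖ N`. -/
def Lift (I : LocalMap 4 n m) (B : BridgeData n m) : Prop :=
  ∀ x : Fin n → Bool, ∃ z : Fin n → Bool, (∀ j ∈ B.J₀ \ B.N, I.eval z j = B.y j) ∧ ∀ v, v ∉ xverts I (B.J₀ \ B.N) → z v = x v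

/-! ## The chord system of the data -/

/-- **The chord system of a terminal core with chord set `N`** on the cube `Fin n → 𝔽₂` (memo §10 "coordinates on V₀"). -/
def sys (I : LocalMap 4 n m) (B : BridgeData n m) : ChordSystem (Fin m) (Fin n → ZMod 2) where
  u e x := uval I B.y (B.D e) e x
  ρ e x := if e ∈ B.N then (coef I B.C₁ B.G₁ (I.vars e 2) x, coef I B.C₂ B.G₂ (I.vars e 2) x) else 0
  ρ' e x := if e ∈ B.N then (coef I B.C₁ B.G₁ (I.vars e 3) x, coef I B.C₂ B.G₂ (I.vars e 3) x) else 0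
  F x := (free I B.y (B.J₀ \ B.N) B.N B.T₁ B.C₁ B.G₁ x, free I B.y (B.J₀ \ B.N) B.N B.T₂ B.C₂ B.G₂ x)
  t := (bit B.b₁, bit B.b₂)

/-- Unfolding the prescribed product. -/
@[simp] theorem sys_u (I : LocalMap 4 n m) (B : BridgeData n m) (e : Fin m) (x : Fin n → ZMod 2) :
    (sys I B).u e x = uval I B.y (B.D e) e x := rfl

/-- Unfolding the target. -/
@[simp] theorem sys_t (I : LocalMap 4 n m) (B : BridgeData n m) : (sys I B).t = (bit B.b₁, bit B.b₂) := rfl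

/-- Unfolding the state-free part. -/
@[simp] theorem sys_F (I : LocalMap 4 n m) (B : BridgeData n m) (x : Fin n → ZMod 2) :
    (sys I B).F x = (free I B.y (B.J₀ \ B.N) B.N B.T₁ B.C₁ B.G₁ x, free I B.y (B.J₀ \ B.N) B.N B.T₂ B.C₂ B.G₂ x) := rfl

/-- Unfolding the read vectors of a chord (chords outside `N` read nothing). -/
theorem sys_ρ (I : LocalMap 4 n m) (B : BridgeData n m) {e : Fin m} (he : e ∈ B.N) (x : Fin n → ZMod 2) :
    (sys I B).ρ e x = (coef I B.C₁ B.G₁ (I.vars e 2) x, coef I B.C₂ B.G₂ (I.vars e 2) x) := if_pos he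

/-- Unfolding the read vectors of a chord (chords outside `N` read nothing). -/
theorem sys_ρ' (I : LocalMap 4 n m) (B : BridgeData n m) {e : Fin m} (he : e ∈ B.N) (x : Fin n → ZMod 2) :
    (sys I B).ρ' e x = (coef I B.C₁ B.G₁ (I.vars e 3) x, coef I B.C₂ B.G₂ (I.vars e 3) x) := if_pos he

/-- Outside `N` the read vectors vanish. -/
theorem sys_ρ_of_not_mem (I : LocalMap 4 n m) (B : BridgeData n m) {e : Fin m} (he : e ∉ B.N) (x : Fin n → ZMod 2) :
    (sys I B).ρ e x = 0 ∧ (sys I B).ρ' e x = 0 := ⟨if_neg he, if_neg he⟩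

/-- **The model's constraint values in closed form.** -/
theorem val_sys (I : LocalMap 4 n m) (B : BridgeData n m) (x : Fin n → ZMod 2) (s : Fin m → ZMod 2 × ZMod 2) :
    (sys I B).val B.N x s =
      (free I B.y (B.J₀ \ B.N) B.N B.T₁ B.C₁ B.G₁ x
          + ∑ e ∈ B.N, ((s e).1 * coef I B.C₁ B.G₁ (I.vars e 2) x + (s e).2 * coef I B.C₁ B.G₁ (I.vars e 3) x),
        free I B.y (B.J₀ \ B.N) B.N B.T₂ B.C₂ B.G₂ x
          + ∑ e ∈ B.N, ((s e).1 * coef I B.C₂ B.G₂ (I.vars e 2) x + (s e).2 * coef I B.C₂ B.G₂ (I.vars e 3) x)) := by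
  unfold ChordSystem.val ChordSystem.contrib
  refine Prod.ext ?_ ?_
  · rw [Prod.fst_add, Prod.fst_sum, sys_F]
    congr 1
    refine sum_congr rfl fun e he => ?_
    rw [sys_ρ I B he, sys_ρ' I B he]
    simp only [Prod.fst_add, Prod.smul_fst, smul_eq_mul]
  · rw [Prod.snd_add, Prod.snd_sum, sys_F]
    congr 1
    refine sum_congr rfl fun e he => ?_
    rw [sys_ρ I B he, sys_ρ' I B he]
    simp only [Prod.snd_add, Prod.smul_snd, smul_eq_mul]

/-! ## From instance solutions to model states -/

/-- **A solution of the non-chord outputs, read in the model.**  With base point `bit ∘ z` and states `(z_{p_e}, z_{q_e})` the model's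
constraint values are `(gval₁ z, gval₂ z)`. -/
theorem val_of_solution (I : LocalMap 4 n m) (hI : I.IsPure xorAndPred) (hT : Typed I) {B : BridgeData n m} (hW : B.WF I)
    {z : Fin n → Bool} (hz : ∀ j ∈ B.J₀ \ B.N, I.eval z j = B.y j) :
    (sys I B).val B.N (fun v => bit (z v)) (fun e => (bit (z (I.vars e 2)), bit (z (I.vars e 3)))) =
      (bit (gval I B.C₁ B.G₁ z), bit (gval I B.C₂ B.G₂ z)) := by
  rw [val_sys, bit_gval_eq I hI hT hW.hN hW.hchord B.y hW.hT₁ B.C₁ B.G₁ hW.hjoin₁ hW.hcross₁ hz,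
    bit_gval_eq I hI hT hW.hN hW.hchord B.y hW.hT₂ B.C₂ B.G₂ hW.hjoin₂ hW.hcross₂ hz]

/-- **A chord holds iff its state is admissible** (the cycle equation of `D e + e`). -/
theorem eval_iff_adm (I : LocalMap 4 n m) (hI : I.IsPure xorAndPred) {B : BridgeData n m} (hW : B.WF I) {z : Fin n → Bool}
    (hz : ∀ j ∈ B.J₀ \ B.N, I.eval z j = B.y j) {e : Fin m} (he : e ∈ B.N) :
    I.eval z e = B.y e ↔ bit (z (I.vars e 2)) * bit (z (I.vars e 3)) = (sys I B).u e (fun v => bit (z v)) := by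
  have heD : e ∉ B.D e := fun h => (mem_sdiff.1 (hW.hD e he h)).2 he
  exact eval_eq_iff_chord I hI B.y (hW.hD e he) heD (hW.hDeven e he) hz

/-- **A solution of the whole terminal system refutes infeasibility of the model** (contrapositive: `Infeasible ⇒ (T3)`-unsolvable). -/
theorem not_infeasible_of_solution (I : LocalMap 4 n m) (hI : I.IsPure xorAndPred) (hT : Typed I) {B : BridgeData n m} (hW : B.WF I)
    {z : Fin n → Bool} (hz : Solution I B B.J₀ z) : ¬ (sys I B).Infeasible B.N := by
  intro hinf
  have hz' : ∀ j ∈ B.J₀ \ B.N, I.eval z j = B.y j := fun j hj => hz.1 j (mem_sdiff.1 hj).1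
  refine hinf (fun v => bit (z v)) (fun e => (bit (z (I.vars e 2)), bit (z (I.vars e 3)))) ?_ ?_
  · intro e he
    exact (eval_iff_adm I hI hW hz' he).1 (hz.1 e (hW.hN he))
  · rw [val_of_solution I hI hT hW hz', hz.2.1, hz.2.2]
    rfl

/-- **(M0) ⇒ chord-minimal.**  A solution of `(J₀ − e) ∧ Γ₁ ∧ Γ₂` for a chord `e ∈ N` makes the model chord-minimal in `e`. -/
theorem chordMinimal_of_solution_erase (I : LocalMap 4 n m) (hI : I.IsPure xorAndPred) (hT : Typed I) {B : BridgeData n m}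
    (hW : B.WF I) {e : Fin m} (he : e ∈ B.N) {z : Fin n → Bool} (hz : Solution I B (B.J₀.erase e) z) :
    (sys I B).ChordMinimal B.N e := by
  have hz' : ∀ j ∈ B.J₀ \ B.N, I.eval z j = B.y j := fun j hj =>
    hz.1 j (mem_erase.2 ⟨fun h => (mem_sdiff.1 hj).2 (h ▸ he), (mem_sdiff.1 hj).1⟩)
  refine ⟨fun v => bit (z v), fun e => (bit (z (I.vars e 2)), bit (z (I.vars e 3))), ?_, ?_⟩
  · intro e' he'
    exact (eval_iff_adm I hI hW hz' (mem_of_mem_erase he')).1 (hz.1 e' (mem_erase.2 ⟨ne_of_mem_erase he', hW.hN (mem_of_mem_erase he')⟩))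
  · rw [val_of_solution I hI hT hW hz', hz.2.1, hz.2.2]
    rfl

/-! ## From model states to instance solutions -/

/-- Decoding `𝔽₂` to `Bool`. -/
def toBool (t : ZMod 2) : Bool := decide (t = 1)

/-- `bit ∘ toBool = id`. -/
@[simp] theorem bit_toBool (t : ZMod 2) : bit (toBool t) = t := by
  unfold toBool; revert t; decide

/-- The prescribed product does not read XOR vertices of `J₀ ∖ N` or privates. -/
theorem uval_congr (I : LocalMap 4 n m) (hT : Typed I) {B : BridgeData n m} (hW : B.WF I) {e : Fin m} (he : e ∈ B.N)
    {x x' : Fin n → ZMod 2} (h : ∀ v, v ∉ xverts I (B.J₀ \ B.N) → v ∉ privs I B.N → x v = x' v) :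
    uval I B.y (B.D e) e x = uval I B.y (B.D e) e x' := by
  unfold uval
  congr 1
  refine sum_congr rfl fun j hj => ?_
  rw [h _ (not_mem_xverts_of_two_le I hT _ j (s := 2) (by decide)) (not_mem_privs_of_mem_sdiff I hW.hN hW.hchord (hW.hD e he hj) 2),
    h _ (not_mem_xverts_of_two_le I hT _ j (s := 3) (by decide)) (not_mem_privs_of_mem_sdiff I hW.hN hW.hchord (hW.hD e he hj) 3)]

/-- A read coefficient of a private does not read XOR vertices or privates (no cross pendant). -/
theorem coef_congr (I : LocalMap 4 n m) (hT : Typed I) {N : Finset (Fin m)} {C : Finset (Fin n)} {G : Finset (Fin m)}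
    (hcross : ∀ g ∈ G, ¬ (I.vars g 2 ∈ privs I N ∧ I.vars g 3 ∈ privs I N)) {p : Fin n} (hp : p ∈ privs I N) (F : Finset (Fin m))
    {x x' : Fin n → ZMod 2} (h : ∀ v, v ∉ xverts I F → v ∉ privs I N → x v = x' v) : coef I C G p x = coef I C G p x' := by
  unfold coef
  congr 1
  refine sum_congr rfl fun g hg => ?_
  congr 1
  · by_cases h2 : I.vars g 2 = p
    · rw [if_pos h2, if_pos h2, h _ (not_mem_xverts_of_two_le I hT F g (s := 3) (by decide)) fun h3 => hcross g hg ⟨h2 ▸ hp, h3⟩]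
    · rw [if_neg h2, if_neg h2]
  · by_cases h3 : I.vars g 3 = p
    · rw [if_pos h3, if_pos h3, h _ (not_mem_xverts_of_two_le I hT F g (s := 2) (by decide)) fun h2 => hcross g hg ⟨h2, h3 ▸ hp⟩]
    · rw [if_neg h3, if_neg h3]

/-- The state-free part does not read XOR vertices of `J₀ ∖ N` or privates. -/
theorem free_congr (I : LocalMap 4 n m) (hT : Typed I) {B : BridgeData n m} (hW : B.WF I) {T : Finset (Fin m)} (hTF : T ⊆ B.J₀ \ B.N)
    (C : Finset (Fin n)) (G : Finset (Fin m)) {x x' : Fin n → ZMod 2}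
    (h : ∀ v, v ∉ xverts I (B.J₀ \ B.N) → v ∉ privs I B.N → x v = x' v) :
    free I B.y (B.J₀ \ B.N) B.N T C G x = free I B.y (B.J₀ \ B.N) B.N T C G x' := by
  unfold free
  congr 1
  · congr 1
    · exact sum_congr rfl fun v hv => h v (mem_filter.1 hv).2.1 (mem_filter.1 hv).2.2
    · refine sum_congr rfl fun j hj => ?_
      rw [h _ (not_mem_xverts_of_two_le I hT _ j (s := 2) (by decide)) (not_mem_privs_of_mem_sdiff I hW.hN hW.hchord (hTF hj) 2),
        h _ (not_mem_xverts_of_two_le I hT _ j (s := 3) (by decide)) (not_mem_privs_of_mem_sdiff I hW.hN hW.hchord (hTF hj) 3)]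
  · refine sum_congr rfl fun g hg => ?_
    have hg' := (mem_filter.1 hg).2
    push Not at hg'
    rw [h _ (not_mem_xverts_of_two_le I hT _ g (s := 2) (by decide)) hg'.1, h _ (not_mem_xverts_of_two_le I hT _ g (s := 3) (by decide)) hg'.2]

/-- **(T3) ⇒ infeasible.**  If the non-chord part lifts and the terminal system `J₀ ∧ Γ₁ ∧ Γ₂` has no solution, the model is infeasible:
an admissible state hitting the target at some base point would be realised by an assignment (lift the base point, then overwrite the
privates by the states). -/
theorem infeasible_of_not_solution (I : LocalMap 4 n m) (hI : I.IsPure xorAndPred) (hT : Typed I) {B : BridgeData n m} (hW : B.WF I)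
    (hL : Lift I B) (hno : ¬ ∃ z, Solution I B B.J₀ z) : (sys I B).Infeasible B.N := by
  intro x₀ s hadm hval
  apply hno
  -- lift the base point, then impose the states on the privates
  obtain ⟨z₁, hz₁, hz₁x⟩ := hL fun v => toBool (x₀ v)
  let sB : Fin m → Bool × Bool := fun e => (toBool (s e).1, toBool (s e).2)
  let z : Fin n → Bool := setPriv I B.N sB z₁
  have hzF : ∀ j ∈ B.J₀ \ B.N, I.eval z j = B.y j := fun j hj => by
    rw [eval_setPriv_of_mem_sdiff I hW.hN hW.hchord sB z₁ hj]; exact hz₁ j hj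
  -- the new base point agrees with `x₀` where it matters, the new states with `s` on `N`
  have hagree : ∀ v, v ∉ xverts I (B.J₀ \ B.N) → v ∉ privs I B.N → x₀ v = bit (z v) := by
    intro v hvx hvp
    show x₀ v = bit (setPriv I B.N sB z₁ v)
    rw [setPriv_of_not_mem I sB z₁ hvp, hz₁x v hvx, bit_toBool]
  have hs2 : ∀ e ∈ B.N, bit (z (I.vars e 2)) = (s e).1 := fun e he => by
    show bit (setPriv I B.N sB z₁ (I.vars e 2)) = _
    rw [setPriv_two I hW.hN hW.hchord sB z₁ he]; exact bit_toBool _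
  have hs3 : ∀ e ∈ B.N, bit (z (I.vars e 3)) = (s e).2 := fun e he => by
    show bit (setPriv I B.N sB z₁ (I.vars e 3)) = _
    rw [setPriv_three I hI hW.hN hW.hchord sB z₁ he]; exact bit_toBool _
  have hval' : (sys I B).val B.N (fun v => bit (z v)) (fun e => (bit (z (I.vars e 2)), bit (z (I.vars e 3)))) = (sys I B).val B.N x₀ s := by
    rw [val_sys, val_sys, free_congr I hT hW hW.hT₁ B.C₁ B.G₁ hagree, free_congr I hT hW hW.hT₂ B.C₂ B.G₂ hagree]
    refine Prod.ext ?_ ?_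
    · simp only
      congr 1
      refine sum_congr rfl fun e he => ?_
      rw [hs2 e he, hs3 e he, coef_congr I hT hW.hcross₁ (vars_mem_privs I he (s := 2) (by decide)) _ hagree,
        coef_congr I hT hW.hcross₁ (vars_mem_privs I he (s := 3) (by decide)) _ hagree]
    · simp only
      congr 1
      refine sum_congr rfl fun e he => ?_
      rw [hs2 e he, hs3 e he, coef_congr I hT hW.hcross₂ (vars_mem_privs I he (s := 2) (by decide)) _ hagree,
        coef_congr I hT hW.hcross₂ (vars_mem_privs I he (s := 3) (by decide)) _ hagree]
  refine ⟨z, fun j hj => ?_, ?_, ?_⟩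
  · by_cases hjN : j ∈ B.N
    · rw [eval_iff_adm I hI hW hzF hjN, hs2 j hjN, hs3 j hjN, hadm j hjN, sys_u, sys_u]
      exact uval_congr I hT hW hjN hagree
    · exact hzF j (mem_sdiff.2 ⟨hj, hjN⟩)
  · apply bit_injective
    have := congrArg Prod.fst (val_of_solution I hI hT hW hzF)
    rw [hval', hval] at this
    exact this.symm
  · apply bit_injective
    have := congrArg Prod.snd (val_of_solution I hI hT hW hzF)
    rw [hval', hval] at this
    exact this.symm

/-- **Summary: the model is infeasible iff the terminal system is unsolvable** (given the lift property). -/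
theorem infeasible_iff (I : LocalMap 4 n m) (hI : I.IsPure xorAndPred) (hT : Typed I) {B : BridgeData n m} (hW : B.WF I)
    (hL : Lift I B) : (sys I B).Infeasible B.N ↔ ¬ ∃ z, Solution I B B.J₀ z :=
  ⟨fun h ⟨_, hz⟩ => not_infeasible_of_solution I hI hT hW hz h, infeasible_of_not_solution I hI hT hW hL⟩

end Summit.PneNP.PneNP.Theorems.PstarChordBridge
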